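import Summits.ResolutionOfSingularities.ResolutionOfSingularities.Theorems.EquisingularLiftEquisingularLiftNatCarrierDeltaPointed
import Summits.ResolutionOfSingularities.ResolutionOfSingularities.Theorems.EquisingularLiftEquisingularLiftNatClusterPointChartChange
import Summits.ResolutionOfSingularities.ResolutionOfSingularities.Theorems.EquisingularLiftEquisingularLiftNatDeltaConeLiftPlane
import HarnessLib

/-!
# [OURS · L1 W4.5(b) · EL♮(3)] (δ) D5 sub-brick: MEMBER CLAUSE (v) OFF THE CLUSTER POINTS — regular quotient stalks of codimension `2`
# at a special point of the Δ-centre `E ⊔ St_{τ₁} K₀` read on a GOOD CHART (res-L1-w45b-stub-2's B5 with D1's pointed Δ-clause)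

Crux chain w45b (cell `res-hironaka`, slot W4.5(b)), working crux **EL♮** = stmt-ResolutionOfSingularities-20038, child **EL♮(3)** =
stmt-ResolutionOfSingularities-20148, route EquisingularLift, line `sections`, registered stub `stub_elnat_tcPlusPlusPointResolution` (v2);
brick **(δ) D5 MEMBER_S**, clause (v) (res-L1-w45b-stub-3 `DELTA-PLAN.md`; res-L1-w45b-plan-1 BOOKING 2026-08-27T16:20:41Z: D5/D6 :=
res-type-100). HONEST FRAMING: OURS; NOT a statement of any manuscript; AI-written, weaker than expert review. No `sorry`; standard axioms.
DEF-FREE. `--supports stmt-ResolutionOfSingularities-20148 --as helper`.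

WHAT (namespace `…Cruxes.EquisingularLiftNat.Sections`).
* `forall_frac_sub_mem_of_stalkMap_comm_sq` — **a coordinate clause goes DOWN the model square**: in `j₂ ≫ τ₁ = υ ≫ j`, for a point
  `w` with `τ₁ (j₂ w) = j (υ w)`, a frame `c` at `j (υ w)` whose image `c̄ = j♯ c` generates the centre of the downstairs blowing up `υ`,
  a chart-`l` map `χ↑ : 𝒪[J/c_l] → 𝒪_{X₁,j₂ w}` over `τ₁♯` and a chart-`l` presentation `χ↓` of `𝒪_{F₂,w}` (on `c̄`): if `χ↑(c_l′/c_l) − τ₁♯ b_l′ ∈ 𝔪_{j₂ w}`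
  for all `l′` then `c̄_l′/c̄_l − j♯ b_l′ ∈ 𝔔↓` for all `l′` (both `j₂♯ χ↑(c_l′/c_l)` and `χ↓(c̄_l′/c̄_l)` solve `u · υ♯c̄_l = υ♯c̄_l′`, and
  `υ♯c̄_l` is a non-zero-divisor — res-type-100's B6a pattern p541628).
* `forall_quotient_span_congr_pointed` — `subst` transport of a pointed Δ-clause along `f = g`.
* **`isRegularLocalRing_quotient_carrierDelta_of_goodChart`** — B5 (`isRegularLocalRing_quotient_carrierDelta_of_ne_conePoint`) for the
  CLUSTER-centred member: binders of the driver's point step at relative dimension `3` (model squares `j`, `j₂`, section `s`, blow-ups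
  `τ₁`, `υ`, `hcomm`, `hcarrier`), the frame `c` at `j x` with `θR : 𝒪/(c) ≅ O`, a uniformizer `ϖ`, a cone form `Φ ∈ O[T₀,T₁,T₂]_d` with
  `ι_*Φ ≢ 0 mod (c)`, ANY cone ideal sheaf `K₀` with `K₀_{j x} = ((ι_*Φ)(c))`; a point `w ∈ F₂` over `x` with `j₂ w` on the special part of
  `supp (E ⊔ St K₀)`, READ ON A GOOD CHART `l`: a chart-`l` presentation of `𝒪_{F₂,w}` on `c̄` at which `w` is NOT any of the excluded
  coordinate points `b̄_e = j♯ ι b_e` (`¬ ∀ l′, c̄_l′/c̄_l − b̄_e l′ ∈ 𝔔`), while the Δ-criterion for `Φ(T_l := 1)` holds at every prime over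
  `ϖ` not containing a whole family `(T_l′ − b_e l′)` (res-L1-w45b-stub-3's D1 clause on the chart `l`, p548257, exclusions in pointed form).
  CONCLUSION: `𝒪_{X₁,j₂ w} ⧸ (E ⊔ St K₀)_{j₂ w}` is a regular local ring and `dim + 2 = dim 𝒪_{X₁,j₂ w}`.

References: res-L1-w45b-stub-2 …NatCarrierDeltaOffVertex (B5); res-type-100 …NatCarrierDeltaPointed, …NatUncentredConeGerm (p533707),
…NatConePointPresentation (p541628); H. Matsumura, *Commutative Ring Theory*, Thm. 14.2 [cite: Matsumura1987, Thm. 14.2; StacksProject, Tag 0804].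
-/

set_option linter.dupNamespace false -- mandated namespace `Summit.<Summit>.<Problem>` of this single-conjunct summit
set_option linter.overlappingInstances false -- the binders carry `[IsDomain O] [IsDiscreteValuationRing O]`

noncomputable section

open CategoryTheory CategoryTheory.Limits AlgebraicGeometry TopologicalSpace IsLocalRing
open Literature.AlgebraicGeometry.Resolution
open AlgebraicGeometry.Scheme.IdealSheafData
open Summit.ResolutionOfSingularities.ResolutionOfSingularities.Cruxes.EquisingularLift.StrataSplit

namespace Summit.ResolutionOfSingularities.ResolutionOfSingularities.Cruxes.EquisingularLiftNat.Sections

universe u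

/-! ## 1. A coordinate clause goes down the model square -/

set_option maxHeartbeats 400000 in -- subalgebra-of-localisation instances are slow (cf. p541628)
/-- **A coordinate clause goes down the model square** (see the module docstring). [cite: StacksProject, Tag 0804] -/
theorem forall_frac_sub_mem_of_stalkMap_comm_sq {X' X₁ F₁ F₂ : Scheme.{u}} (τ₁ : X₁ ⟶ X') (j : F₁ ⟶ X') (j₂ : F₂ ⟶ X₁)
    (υ : F₂ ⟶ F₁) (hcomm : j₂ ≫ τ₁ = υ ≫ j) (w : F₂) (hzp : τ₁ (j₂ w) = j (υ w))
    (hx : IsClosed ({υ w} : Set F₁)) (hυ : IsBlowup υ (vanishingIdeal (⟨{υ w}, hx⟩ : Closeds F₁)))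
    {k : ℕ} (c : Fin k → X'.presheaf.stalk (j (υ w)))
    (hcb : Ideal.span (Set.range fun i => (j.stalkMap (υ w)).hom (c i)) =
      stalkIdeal (vanishingIdeal (⟨{υ w}, hx⟩ : Closeds F₁)) (υ w)) (l : Fin k)
    (χu : blowupAlgebra (Ideal.span (Set.range c)) (c l) →+* X₁.presheaf.stalk (j₂ w))
    (hχu : ∀ a, χu (algebraMap _ _ a) = ((X'.presheaf.stalkCongr (.of_eq hzp)).inv ≫ τ₁.stalkMap (j₂ w)).hom a)
    (𝔔d : PrimeSpectrum (blowupAlgebra (Ideal.span (Set.range fun i => (j.stalkMap (υ w)).hom (c i)))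
      ((j.stalkMap (υ w)).hom (c l))))
    (χd : blowupAlgebra (Ideal.span (Set.range fun i => (j.stalkMap (υ w)).hom (c i))) ((j.stalkMap (υ w)).hom (c l)) →+*
      F₂.presheaf.stalk w)
    (hχd : ∀ r, χd (algebraMap _ _ r) = (υ.stalkMap w).hom r)
    (hlocd : @IsLocalization.AtPrime _ _ (F₂.presheaf.stalk w) _ χd.toAlgebra 𝔔d.asIdeal _)
    (b : {l' : Fin k // l' ≠ l} → X'.presheaf.stalk (j (υ w)))
    (hup : ∀ l' : {l' : Fin k // l' ≠ l}, χu (blowupAlgebra.frac c l l'.1) -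
      ((X'.presheaf.stalkCongr (.of_eq hzp)).inv ≫ τ₁.stalkMap (j₂ w)).hom (b l') ∈ maximalIdeal (X₁.presheaf.stalk (j₂ w))) :
    ∀ l' : {l' : Fin k // l' ≠ l}, blowupAlgebra.frac (fun i => (j.stalkMap (υ w)).hom (c i)) l l'.1 -
      algebraMap _ _ ((j.stalkMap (υ w)).hom (b l')) ∈ 𝔔d.asIdeal := by
  intro l'
  have hχd' : ∀ r, χd (algebraMap _ _ r) =
      ((F₁.presheaf.stalkCongr (.of_eq (rfl : υ w = υ w))).inv ≫ υ.stalkMap w).hom r := fun r => by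
    rw [hχd r, stalkCongr_inv_comp_apply_eq rfl r, TopCat.Presheaf.stalkCongr_hom]
    congr 1
    exact (stalkSpecializes_self_apply F₁.presheaf (υ w) _ r).symm
  -- `υ♯ c̄_l` generates the exceptional stalk downstairs, a non-zero-divisor
  have hE := stalkIdeal_comap_eq_span_of_chartPresentation w rfl (fun i => (j.stalkMap (υ w)).hom (c i)) hcb l χd hχd'
  obtain ⟨t, ht, hKt⟩ := hυ.isEffectiveCartier.exists_stalkIdeal_eq_span w
  rw [hE] at hKt
  have hnzd := mem_nonZeroDivisors_of_span_singleton_eq hKt ht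
  have hgen : ((F₁.presheaf.stalkCongr (.of_eq (rfl : υ w = υ w))).inv ≫ υ.stalkMap w).hom ((j.stalkMap (υ w)).hom (c l)) =
      (υ.stalkMap w).hom ((j.stalkMap (υ w)).hom (c l)) := by
    rw [stalkCongr_inv_comp_apply_eq rfl, TopCat.Presheaf.stalkCongr_hom]
    congr 1
    exact stalkSpecializes_self_apply F₁.presheaf (υ w) _ _
  rw [hgen] at hnzd
  -- both `j₂♯ χ↑(c_l′/c_l)` and `χ↓(c̄_l′/c̄_l)` solve `u · υ♯c̄_l = υ♯c̄_l′`
  have hrelu : χu (blowupAlgebra.frac c l l'.1) * ((X'.presheaf.stalkCongr (.of_eq hzp)).inv ≫ τ₁.stalkMap (j₂ w)).hom (c l) =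
      ((X'.presheaf.stalkCongr (.of_eq hzp)).inv ≫ τ₁.stalkMap (j₂ w)).hom (c l'.1) := apply_frac_mul c l l'.1 χu _ hχu
  have hreld : χd (blowupAlgebra.frac (fun i => (j.stalkMap (υ w)).hom (c i)) l l'.1) *
      (υ.stalkMap w).hom ((j.stalkMap (υ w)).hom (c l)) = (υ.stalkMap w).hom ((j.stalkMap (υ w)).hom (c l'.1)) :=
    apply_frac_mul (fun i => (j.stalkMap (υ w)).hom (c i)) l l'.1 χd _ hχd
  have hdown : (j₂.stalkMap w).hom (χu (blowupAlgebra.frac c l l'.1)) =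
      χd (blowupAlgebra.frac (fun i => (j.stalkMap (υ w)).hom (c i)) l l'.1) := by
    apply (mul_cancel_right_mem_nonZeroDivisors hnzd).mp
    rw [hreld, ← stalkMap_stalkMap_apply_of_comm_sq τ₁ j j₂ υ hcomm w hzp (c l),
      ← map_mul, hrelu, stalkMap_stalkMap_apply_of_comm_sq τ₁ j j₂ υ hcomm w hzp (c l'.1)]
  -- push the upstairs clause down along the local map `j₂♯`
  have h1 : (j₂.stalkMap w).hom (χu (blowupAlgebra.frac c l l'.1) -
      ((X'.presheaf.stalkCongr (.of_eq hzp)).inv ≫ τ₁.stalkMap (j₂ w)).hom (b l')) ∈ maximalIdeal (F₂.presheaf.stalk w) := by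
    refine (mem_maximalIdeal _).mpr (mem_nonunits_iff.mpr fun hu => ?_)
    exact (mem_nonunits_iff.mp ((mem_maximalIdeal _).mp (hup l'))) (IsLocalHom.map_nonunit _ hu)
  rw [map_sub, hdown, stalkMap_stalkMap_apply_of_comm_sq τ₁ j j₂ υ hcomm w hzp (b l')] at h1
  rw [mem_chartPrime_iff_apply_mem_maximalIdeal 𝔔d χd hlocd, map_sub, hχd]
  exact h1

/-- `subst` transport of a pointed Δ-clause along an equality of chart equations. [folklore] -/
theorem forall_quotient_span_congr_pointed {A : Type*} [CommRing A] {f g : A} (hfg : f = g) (a : A) {ι σ : Type*}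
    (fam : ι → σ → A)
    (H : ∀ (Q : Ideal (A ⧸ Ideal.span {g})) [Q.IsPrime], Ideal.Quotient.mk (Ideal.span {g}) a ∈ Q →
      (∀ e, ¬ ∀ l, Ideal.Quotient.mk (Ideal.span {g}) (fam e l) ∈ Q) → IsRegularLocalRing (Localization.AtPrime Q)) :
    ∀ (Q : Ideal (A ⧸ Ideal.span {f})) [Q.IsPrime], Ideal.Quotient.mk (Ideal.span {f}) a ∈ Q →
      (∀ e, ¬ ∀ l, Ideal.Quotient.mk (Ideal.span {f}) (fam e l) ∈ Q) → IsRegularLocalRing (Localization.AtPrime Q) := by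
  subst hfg
  exact H

/-! ## 2. B5 for the cluster-centred member: clause (v) at a special point read on a good chart -/

set_option maxHeartbeats 800000 in -- the chart algebra `blowupAlgebra` is a subalgebra of a localisation: slow instance unification (cf. B5)
/-- **MEMBER CLAUSE (v) OFF THE CLUSTER POINTS, ON A GOOD CHART** (see the module docstring). [cite: Matsumura1987, Thm. 14.2;
StacksProject, Tag 0804] [OURS · L1 W4.5b] (δ) D5; NOT a statement of the manuscript. -/
theorem isRegularLocalRing_quotient_carrierDelta_of_goodChart (k : Type) [Field k]
    (O : Type) [CommRing O] [IsDomain O] [IsDiscreteValuationRing O] (θ : O →+* k) (hθ : Function.Surjective θ)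
    {X' : Scheme.{0}} (r' : X' ⟶ Spec (.of O)) [IsSeparated r'] [IsLocallyNoetherian X']
    (s : Spec (.of O) ⟶ X') (hs : s ≫ r' = 𝟙 _)
    {F₁ : Scheme.{0}} (j : F₁ ⟶ X') (t : F₁ ⟶ Spec (.of k))
    (hsq : IsPullback j t r' (Spec.map (CommRingCat.ofHom θ)))
    (x : F₁) (hx : IsClosed ({x} : Set F₁)) (hsx : s (IsLocalRing.closedPoint O) = j x)
    {X₁ : Scheme.{0}} (τ₁ : X₁ ⟶ X') (hτ₁ : IsBlowup τ₁ s.ker)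
    {F₂ : Scheme.{0}} (υ : F₂ ⟶ F₁) (hυ : IsBlowup υ (vanishingIdeal (⟨{x}, hx⟩ : Closeds F₁)))
    (j₂ : F₂ ⟶ X₁) (hcomm : j₂ ≫ τ₁ = υ ≫ j)
    (hcarrier : (s.ker.comap τ₁).comap j₂ = (vanishingIdeal (⟨{x}, hx⟩ : Closeds F₁)).comap υ)
    -- the frame at `j x`
    (c : Fin 3 → X'.presheaf.stalk (j x)) (hcI : Ideal.span (Set.range c) = stalkIdeal s.ker (j x))
    (hqr : IsQuasiRegular c) [IsDomain (X'.presheaf.stalk (j x) ⧸ Ideal.span (Set.range c))]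
    (θR : (X'.presheaf.stalk (j x) ⧸ Ideal.span (Set.range c)) ≃+* O)
    (hθR : ∀ b : O, θR (Ideal.Quotient.mk _
      (((Scheme.ΓSpecIso (.of O)).inv ≫ r'.appTop ≫ X'.presheaf.Γgerm (j x)).hom b)) = b)
    (ϖ : O) (hϖ : Irreducible ϖ)
    (h𝔪 : Ideal.span (Set.range c) ⊔ Ideal.span {((Scheme.ΓSpecIso (.of O)).inv ≫ r'.appTop ≫ X'.presheaf.Γgerm (j x)).hom ϖ} =
        maximalIdeal (X'.presheaf.stalk (j x)))
    -- the cone form: degree `d`, `ι_*Φ ≢ 0 mod (c)`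
    {d : ℕ} (Φ : MvPolynomial (Fin 3) O) (hΦd : Φ.IsHomogeneous d)
    (hΦc : MvPolynomial.map (Ideal.Quotient.mk (Ideal.span (Set.range c)))
      (MvPolynomial.map ((Scheme.ΓSpecIso (.of O)).inv ≫ r'.appTop ≫ X'.presheaf.Γgerm (j x)).hom Φ) ≠ 0)
    -- the cone ideal sheaf
    (K₀ : X'.IdealSheafData)
    (hK : stalkIdeal K₀ (j x) = Ideal.span {MvPolynomial.eval c (MvPolynomial.map
      ((Scheme.ΓSpecIso (.of O)).inv ≫ r'.appTop ≫ X'.presheaf.Γgerm (j x)).hom Φ)})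
    -- the point, read downstairs on the good chart `l`
    (w : F₂) (hw : υ w = x) (l : Fin 3)
    (𝔔d : PrimeSpectrum (blowupAlgebra (Ideal.span (Set.range fun i => (j.stalkMap x).hom (c i))) ((j.stalkMap x).hom (c l))))
    (χd : blowupAlgebra (Ideal.span (Set.range fun i => (j.stalkMap x).hom (c i))) ((j.stalkMap x).hom (c l)) →+*
      F₂.presheaf.stalk w)
    (hχd : ∀ r, χd (algebraMap _ _ r) = ((F₁.presheaf.stalkCongr (.of_eq hw)).inv ≫ υ.stalkMap w).hom r)
    (hlocd : @IsLocalization.AtPrime _ _ (F₂.presheaf.stalk w) _ χd.toAlgebra 𝔔d.asIdeal _)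
    -- the excluded coordinate families (lifted to `O`) and the pointed Δ-clause on the chart `l`
    {ι : Type} (bO : ι → {l' : Fin 3 // l' ≠ l} → O)
    (hnot : ∀ e, ¬ ∀ l' : {l' : Fin 3 // l' ≠ l},
      blowupAlgebra.frac (fun i => (j.stalkMap x).hom (c i)) l l'.1 -
        algebraMap _ _ ((j.stalkMap x).hom (((Scheme.ΓSpecIso (.of O)).inv ≫ r'.appTop ≫ X'.presheaf.Γgerm (j x)).hom
          (bO e l'))) ∈ 𝔔d.asIdeal)
    (hΔ : ∀ (Q : Ideal (MvPolynomial {l' : Fin 3 // l' ≠ l} O ⧸ Ideal.span {dehomogenize l Φ})) [Q.IsPrime],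
      Ideal.Quotient.mk _ (MvPolynomial.C ϖ : MvPolynomial {l' : Fin 3 // l' ≠ l} O) ∈ Q →
      (∀ e, ¬ ∀ l', Ideal.Quotient.mk _ (MvPolynomial.X l' - MvPolynomial.C (bO e l')) ∈ Q) →
        IsRegularLocalRing (Localization.AtPrime Q))
    (hz : j₂ w ∈ ((s.ker.comap τ₁ ⊔ strictTransformIdeal τ₁ s.ker K₀).support : Set X₁)) :
    IsRegularLocalRing (X₁.presheaf.stalk (j₂ w) ⧸ stalkIdeal (s.ker.comap τ₁ ⊔ strictTransformIdeal τ₁ s.ker K₀) (j₂ w)) ∧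
      ringKrullDim (X₁.presheaf.stalk (j₂ w) ⧸ stalkIdeal (s.ker.comap τ₁ ⊔ strictTransformIdeal τ₁ s.ker K₀) (j₂ w)) + 2 =
        ringKrullDim (X₁.presheaf.stalk (j₂ w)) := by
  classical
  -- adapted from res-L1-w45b-stub-2's B5 `isRegularLocalRing_quotient_carrierDelta_of_ne_conePoint` (…NatCarrierDeltaOffVertex)
  have hϖO : ϖ ∈ maximalIdeal O := by rw [hϖ.maximalIdeal_eq]; exact Ideal.mem_span_singleton_self ϖ
  haveI : IsProper τ₁ := hτ₁.isProper
  haveI : IsLocallyNoetherian X₁ := LocallyOfFiniteType.isLocallyNoetherian τ₁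
  haveI : IsClosedImmersion (Spec.map (CommRingCat.ofHom θ)) := IsClosedImmersion.spec_of_surjective _ hθ
  haveI : IsClosedImmersion j := MorphismProperty.IsStableUnderBaseChange.of_isPullback hsq.flip inferInstance
  have hϖ𝔪 : ((Scheme.ΓSpecIso (.of O)).inv ≫ r'.appTop ≫ X'.presheaf.Γgerm (j x)).hom ϖ ∈
      maximalIdeal (X'.presheaf.stalk (j x)) := h𝔪 ▸ Ideal.mem_sup_right (Ideal.mem_span_singleton_self _)
  have hpJ : j x ∈ (s.ker.support : Set X') := by
    obtain ⟨-, -, -, hsupp⟩ := section_isClosedImmersion_and_isRegular_ker O X' r' s hs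
    rw [hsupp, ← hsx]; exact Set.mem_range_self _
  have hρ : (θR.toRingHom.comp (Ideal.Quotient.mk (Ideal.span (Set.range c)))).comp
      ((Scheme.ΓSpecIso (.of O)).inv ≫ r'.appTop ≫ X'.presheaf.Γgerm (j x)).hom = RingHom.id O :=
    RingHom.ext fun b => hθR b
  have hΦd' : (MvPolynomial.map ((Scheme.ΓSpecIso (.of O)).inv ≫ r'.appTop ≫ X'.presheaf.Γgerm (j x)).hom Φ).IsHomogeneous d :=
    hΦd.map _
  haveI : IsRegularRing (X'.presheaf.stalk (j x) ⧸ Ideal.span (Set.range c)) := IsRegularRing.of_ringEquiv θR.symm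
  -- orientation `E ⊔ St K₀ = St K₀ ⊔ E` (the kit's)
  rw [show s.ker.comap τ₁ ⊔ strictTransformIdeal τ₁ s.ker K₀ = strictTransformIdeal τ₁ s.ker K₀ ⊔ s.ker.comap τ₁ from
    sup_comm _ _] at hz ⊢
  have hzp : τ₁ (j₂ w) = j x := by rw [← Scheme.Hom.comp_apply, hcomm, Scheme.Hom.comp_apply, hw]
  refine ⟨?_, ringKrullDim_quotient_carrierDelta_add_two hτ₁ _ (j₂ w) (j x) hzp hpJ c hcI hqr _ hΦd' hΦc hK hz⟩
  subst hw
  -- downstairs: `c̄_l` generates `(𝔪_x·𝒪_{F₂})_w` (chart-`l` presentation); transfer up the model square: `τ₁♯(c_l)` generates `E_z`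
  have hcb : Ideal.span (Set.range fun i => (j.stalkMap (υ w)).hom (c i)) =
      stalkIdeal (vanishingIdeal (⟨{υ w}, hx⟩ : Closeds F₁)) (υ w) := by
    rw [span_stalkMap_eq_maximalIdeal_of_model θ hθ r' j t hsq (υ w) ϖ hϖO c h𝔪, stalkIdeal_vanishingIdeal_singleton hx]
  have hEw := stalkIdeal_comap_eq_span_of_chartPresentation w rfl (fun i => (j.stalkMap (υ w)).hom (c i)) hcb l χd hχd
  have hEw' : stalkIdeal ((vanishingIdeal (⟨{υ w}, hx⟩ : Closeds F₁)).comap υ) w =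
      Ideal.span {(υ.stalkMap w).hom ((j.stalkMap (υ w)).hom (c l))} := by
    rw [hEw, CommRingCat.comp_apply, TopCat.Presheaf.stalkCongr_inv, stalkSpecializes_self_apply F₁.presheaf (υ w)]
  have hcl : c l ∈ stalkIdeal s.ker (j (υ w)) := hcI ▸ Ideal.subset_span (Set.mem_range_self l)
  have hEz := stalkIdeal_eq_span_of_comap_eq_span hτ₁ j j₂ υ hcomm hυ.isEffectiveCartier hcarrier w hzp hcl hEw'
  have hχd' : ∀ r, χd (algebraMap _ _ r) = (υ.stalkMap w).hom r := fun r => by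
    rw [hχd r, CommRingCat.comp_apply, TopCat.Presheaf.stalkCongr_inv, stalkSpecializes_self_apply F₁.presheaf (υ w)]
  -- clause (v) on the chart `c_l`, POINTED (Δ-clause for `ρ = θR ∘ mk`, exclusions `bO`)
  refine isRegularLocalRing_stalk_quotient_carrierDelta_of_generator_pointed hτ₁ K₀ (j₂ w) (j (υ w)) hzp hpJ c hcI hqr _ hΦd'
    hΦc hK (r'.appTop.hom ((Scheme.ΓSpecIso (.of O)).inv.hom ϖ)) hϖ𝔪 θR l hEz bO
    (fun e l' => ((Scheme.ΓSpecIso (.of O)).inv ≫ r'.appTop ≫ X'.presheaf.Γgerm (j (υ w))).hom (bO e l'))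
    (fun e l' => hθR (bO e l')) (fun 𝔓 _ h𝔓 hex => ?_) (fun _ χu hχu _ e hall => ?_) hz
  · -- the Δ-clause: `θR ϖ̄ = ϖ`, `(θR ∘ mk)_* ((ι_*Φ)(T_l := 1)) = Φ(T_l := 1)`
    have hθϖ : θR (Ideal.Quotient.mk _ ((X'.presheaf.Γgerm (j (υ w))).hom (r'.appTop.hom ((Scheme.ΓSpecIso (.of O)).inv.hom ϖ)))) =
        ϖ := hθR ϖ
    rw [hθϖ] at h𝔓
    exact forall_quotient_span_congr_pointed (map_dehomogenize_map_of_comp_eq_id _ _ hρ l Φ) (MvPolynomial.C ϖ)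
      (fun e l' => MvPolynomial.X l' - MvPolynomial.C (bO e l')) hΔ 𝔓 h𝔓 hex
  · -- the point is not an excluded coordinate point: push the clause down the model square
    exact hnot e (forall_frac_sub_mem_of_stalkMap_comm_sq τ₁ j j₂ υ hcomm w hzp hx hυ c hcb l χu hχu 𝔔d χd hχd'
      hlocd _ hall)

end Summit.ResolutionOfSingularities.ResolutionOfSingularities.Cruxes.EquisingularLiftNat.Sections

end
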